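import Summits.QuantumFields.YangMills.Theorems.FluctuationComparisonRegPrIntLS2BetaGapFlatOfStabiliserLift
import HarnessLib

/-!
# S2β · PROP. 7 CLAUSE 1 ⟹ THE LIFTING TOKEN: at print's regular minimiser `U₀` over ANY datum `V`, «every symmetry of `V` is the descent of a symmetry of `U₀`»
# (`hlift`, seam (b)'s one token) FOLLOWS from «at most one critical (4)-orbit in (6)(ε₀) over `V`» — so GAP♭(V,U₀) ⟸ PROP. 7 CL. 1 AT `(ε₀, V)` ALONE

Cell `ym3-torus` (YM ladder rung R3 = continuum `SU(2)` Yang–Mills on T³ at fixed lattice data — NOT d = 4, NOT infinite volume, NOT a mass gap, NOT Clay).  Width seat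
`ym3-torus-px17` (gen 16), FREE px helper of crux `stmt-QuantumFields-20520`; `--supports … --as helper`, count-neutral, DEFINITION-FREE (0 `def`∕`instance`∕`notation`, default heartbeats).

WHY.  On the per-datum GAP♭ road the (T)-chain displays, after ✓`…S2BetaGapFlatOfStabiliserLift` (FILE 1), ONE per-datum letter: `hlift`(V,U₀) — used TWICE, on the POS∘ side
((T7-red): near the full orbit ⟹ near the residual orbit) and on the ISOL∘ side (pen 7 §4 ⟹ Prop. 7 cl. 1 ⟹ ✓px8 `isol_of_atMostOneCriticalOrbit`).  THIS FILE observes that the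
token is not an extra hypothesis at all: it is IMPLIED by Prop. 7 clause 1 at `(ε₀, V)` (print's statement, [Balaban1985Variational] p.299) at any minimiser `U₀` of the Wilson action
over `regFibrePr ε₀ V`.  MECHANISM (§1, pure kinematics, zero thresholds): for a symmetry `s` of `V` (`s • V = V`) take ANY lift `κ` (`κ↓ = s`, lit ✓`liftTransfTo`); by the gauge
invariance of (6) and of the action (lit ✓`gaugeAct_mem_regFibrePr_iff`, ✓`wilsonAction4_gaugeAct`) `κ • U₀` is again a minimiser over `regFibrePr ε₀ (s • V) = regFibrePr ε₀ V`, hence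
R2-critical (lit ✓`isCritR2_of_isMinOn`); Prop. 7 cl. 1 puts `κ • U₀` on the (4)-orbit of `U₀`: `κ • U₀ = u • U₀` with `u↓ = 1`; so `k := u⁻¹κ` fixes `U₀` and `k↓ = (u↓)⁻¹(κ↓) = s`
(lit ✓`descTransf_mul` ∕ `descTransf_inv`).  Conversely ✓FILE 1 §2 (pen 7 §4 witnessed by `U₀`): `hlift`(V,U₀) at an R2-critical regular `U₀` ⟹ Prop. 7 cl. 1.  Hence:
* §1 ★★★ `symmetriesLift_of_atMostOneCriticalOrbit (F) (hJK) (hε₀) (V U₀) (h1 : AtMostOneCriticalOrbit ε₀ V) (hU₀ : U₀ ∈ regFibrePr ε₀ V) (hmin : A U₀ = minActionRegPr ε₀ V) : hlift(V,U₀)`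
  — EVERY member, EVERY `ε₀ > 0`, EVERY datum; no `L ≥ 5`.
* §2 ★★ `atMostOneCriticalOrbit_iff_symmetriesLift_at_min_five` — at `L ≥ 5`, `0 < ε₀ ≤ e₈(L)`, at a minimiser `U₀ ∈ regFibrePr ε₀ V`: PROP. 7 CL. 1 at `(ε₀, V)` ⟺ `hlift`(V,U₀).
* §3 ★★★★ `gapFlat_at_min_of_atMostOneCriticalOrbit_of_hreg_five` ∕ ★★★★ `gapFlat_at_min_of_atMostOneCriticalOrbit_five` — GAP♭(V,U₀) ⟸ {PROP. 7 CL. 1 at `(ε₀, V)`, `hreg`(δ)} uniformly in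
  `γ ≤ γ*(L,b₀,p₀,δ)`, and ⟸ PROP. 7 CL. 1 ALONE at a per-base-point `γ ≤ γ*(U₀)`; ★★★ `tubeGrowth_smallTube_at_min_of_atMostOneCriticalOrbit_of_CL_five` — TUBE♭ for small tubes
  ⟸ {PROP. 7 CL. 1, CL(V)}.  (✓FILE 1 §3∕§4 ∘ §1.)
WHAT IT DOES FOR THE BOARD: the per-datum letters of the whole (T)-chain (POS∘'s IRR∕`hlift`∕(Lπ)_loc∕`hcont`, ISOL∘) collapse to PRINT'S OWN STATEMENT Prop. 7 cl. 1 at the pair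
`(ε₀, V)` plus the base-point rows {`U₀ ∈ regFibrePr ε₀ V`, `A U₀ = minActionRegPr ε₀ V`} (EXW∘'s) — the registered schema `Prop7AtMostOneCriticalOrbitAt`'s currency; px12 g21 (B) FILE 4
(`…S2BetaCriticalOrbitUniqueOfExab`: Prop. 7 cl. 1 at every `PlaqSmall` datum modulo EX^{ab} at σ₃-diagonal representatives) then feeds §3 at every datum.  NOT done: Prop. 7 cl. 1 itself
beyond the landed strata, the organ's datum-free `δ`∕`γ` and K-uniform `μ` (TUBE-REG∘ as registered — RECORD 17gh), GAP♯∘, EXW∘.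

HONEST: kinematics + composition BY NAME over landed theorems; nothing of Bałaban's analysis beyond the cited tree theorems; Prop. 7 cl. 1 at general data, `hreg` at general δ, TUBE-REG∘'s
uniform order, GAP♯∘, EXW∘, S2β, crux 20520 NOT proved; `L = 3` socket open (EMBARGO-LITE №58); no summit statement is proved by a helper; finite-volume ∕ conditional; rung R3 =
SU(2) YM₃ on T³ — NOT d = 4, NOT infinite volume, NOT a mass gap, NOT Clay; the Yang–Mills mass gap is NOT proved.  No `sorry`, axioms standard.

References: T. Bałaban, CMP **102** (1985) 277–309 [Balaban1985Variational] ((2)–(6) p.278 and the sentence after (3), Thm 1 (8)–(10) p.279, Prop. 7 and (141)–(143) p.299); CMP **102**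
(1985) 255–275 [Balaban1985UV3] ((12)–(13) p.259, (18)–(22) p.260); CMP **98** (1985) 17–51 [Balaban1985Averaging] ((8), (11)–(13) p.19); CMP **99** (1985) 75–102
[Balaban1985RegularSpaces] (Lemma 1 p.79, Thm 2 p.83).
-/

set_option autoImplicit false

noncomputable section

namespace Summit.QuantumFields.YangMills.Theorems.FluctuationComparisonRegPrIntLS2BetaLiftOfCriticalOrbitUnique

open Set Filter Topology Function
open scoped Matrix.Norms.L2Operator
open Literature.MathematicalPhysics.QuantumFieldTheory.Balaban1983to89
open Literature.MathematicalPhysics.QuantumFieldTheory.Balaban1983to89.T3ContinuumYM3Torus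
open Literature.MathematicalPhysics.QuantumFieldTheory.Balaban1983to89.T3UnitLawDensityEML (ℰp)
open Literature.MathematicalPhysics.QuantumFieldTheory.Balaban1983to89.T3UnitScaleTilt
open Literature.MathematicalPhysics.QuantumFieldTheory.Balaban1983to89.T3TiltDescent
open Literature.MathematicalPhysics.QuantumFieldTheory.Balaban1983to89.T3ConstrainedMinimiser (fibre)
open Literature.MathematicalPhysics.QuantumFieldTheory.Balaban1983to89.T3PrintedRegularMinimiser
open Literature.MathematicalPhysics.QuantumFieldTheory.Balaban1983to89.T3PrintedRegularOrbits
  (descTransf descendTo_gaugeAct liftTransfTo descTransf_liftTransfTo gaugeAct_mem_regFibrePr_iff)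
open Literature.MathematicalPhysics.QuantumFieldTheory.Balaban1983to89.T3SectALandauChart (descTransf_mul descTransf_inv)
open Literature.MathematicalPhysics.QuantumFieldTheory.Balaban1983to89.T3UnitLawGaugeInvariance (gaugeAct_gaugeAct)
open Literature.MathematicalPhysics.QuantumFieldTheory.Balaban1983to89.T3Thm1Carrier (varProblem3)
open Literature.MathematicalPhysics.QuantumFieldTheory.Balaban1983to89.T3Thm1CarrierNative (IsCritR2 isCritR2_of_isMinOn)
open Literature.MathematicalPhysics.QuantumFieldTheory.Balaban1983to89.T4Continuum
open scoped Literature.MathematicalPhysics.QuantumFieldTheory.Balaban1983to89.T3OrbitAverage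
open Summit.QuantumFields.YangMills.Theorems.FluctuationComparisonRegPrIntLS2BetaResidualGauge (wilsonAction4_gaugeAct)
open Summit.QuantumFields.YangMills.Theorems.FluctuationComparisonRegPrIntLS2BetaGapFlatOfStabiliserLift

/-! ## §1 Prop. 7 clause 1 ⟹ the lifting token at any minimiser (zero thresholds) -/

section Lift

variable (F : T3Family) {J K : ℕ} (hJK : J ≤ K)

/-- ★★★ **PROP. 7 CLAUSE 1 AT `(ε₀, V)` ⟹ EVERY SYMMETRY OF THE DATUM LIFTS TO A SYMMETRY OF THE MINIMISER.**  At every member, every `ε₀ > 0`, every datum `V` with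
`(varProblem3 F J K hJK).AtMostOneCriticalOrbit ε₀ V`, and every `U₀ ∈ regFibrePr ε₀ V` realising `minActionRegPr ε₀ V`: for every gauge transformation `s` of the comparison lattice
with `s • V = V` there is `k` with `k • U₀ = U₀` and `k↓ = s` (✓pen 4's ∕ (T7-red)'s `hlift` binder VERBATIM at `U₀`).  Proof: lift `s` to `κ` (`κ↓ = s`); `κ • U₀` is a minimiser over
`regFibrePr ε₀ (s • V) = regFibrePr ε₀ V` (gauge invariance of (6) and of the action), hence R2-critical; Prop. 7 cl. 1 gives `κ • U₀ = u • U₀` with `u↓ = 1`; `k := u⁻¹κ`.  ZERO thresholds.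
[cite: Balaban1985Variational, (4)-(6) p.278 and the sentence after (3), Thm 1 (8) p.279, Prop. 7 p.299; Balaban1985Averaging, (8) and (11)-(13) p.19] -/
theorem symmetriesLift_of_atMostOneCriticalOrbit {ε₀ : ℝ} (hε₀ : 0 < ε₀)
    (V : GaugeField (F.P J) 0 (Matrix.specialUnitaryGroup (Fin 2) ℂ)) (U₀ : GaugeField (F.P K) 0 (Matrix.specialUnitaryGroup (Fin 2) ℂ))
    (h1 : (varProblem3 F J K hJK).AtMostOneCriticalOrbit ε₀ V)
    (hU₀ : U₀ ∈ regFibrePr F J K hJK ε₀ V) (hmin : wilsonAction4 U₀ = minActionRegPr F J K hJK ε₀ V) :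
    ∀ s : GaugeTransf (F.P J) 0 (Matrix.specialUnitaryGroup (Fin 2) ℂ), GaugeField.gaugeAct s V = V →
      ∃ k : GaugeTransf (F.P K) 0 (Matrix.specialUnitaryGroup (Fin 2) ℂ), GaugeField.gaugeAct k U₀ = U₀ ∧ descTransf F J K hJK k = s := by
  intro s hs
  -- any lift `κ` of `s`
  obtain ⟨κ, hκ⟩ : ∃ κ : GaugeTransf (F.P K) 0 (Matrix.specialUnitaryGroup (Fin 2) ℂ), descTransf F J K hJK κ = s :=
    ⟨liftTransfTo F J K hJK s, descTransf_liftTransfTo F J K hJK s⟩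
  -- `κ • U₀` is again a minimiser over `regFibrePr ε₀ V`
  have hκU : GaugeField.gaugeAct κ U₀ ∈ regFibrePr F J K hJK ε₀ V := by
    have h := (gaugeAct_mem_regFibrePr_iff F hJK hε₀.le κ U₀ V).mpr hU₀
    rwa [hκ, hs] at h
  have hκmin : wilsonAction4 (GaugeField.gaugeAct κ U₀) = minActionRegPr F J K hJK ε₀ V := by
    rw [wilsonAction4_gaugeAct F κ U₀]; exact hmin
  -- both are R2-critical
  have hc0 : IsCritR2 F J K hJK V U₀ :=
    isCritR2_of_isMinOn hε₀ hU₀ (isMinOn_iff.mpr fun W hW => hmin.trans_le (minActionRegPr_le F hW))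
  have hc1 : IsCritR2 F J K hJK V (GaugeField.gaugeAct κ U₀) :=
    isCritR2_of_isMinOn hε₀ hκU (isMinOn_iff.mpr fun W hW => hκmin.trans_le (minActionRegPr_le F hW))
  -- Prop. 7 clause 1: one (4)-orbit
  obtain ⟨u, hu1, hu⟩ := h1 U₀ (GaugeField.gaugeAct κ U₀) ((mem_regFibrePr_iff F).1 hU₀).2 ((mem_regFibrePr_iff F).1 hU₀).1 hc0
    ((mem_regFibrePr_iff F).1 hκU).2 ((mem_regFibrePr_iff F).1 hκU).1 hc1
  -- `k := u⁻¹ κ`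
  refine ⟨fun x => (u x)⁻¹ * κ x, ?_, ?_⟩
  · rw [← gaugeAct_gaugeAct (fun x => (u x)⁻¹) κ U₀, hu, gaugeAct_gaugeAct]
    have h1' : (fun x => (u x)⁻¹ * u x) = fun _ : Site (F.P K) 0 => (1 : Matrix.specialUnitaryGroup (Fin 2) ℂ) := funext fun x => inv_mul_cancel _
    rw [h1']
    funext b
    simp [GaugeField.gaugeAct]
  · rw [descTransf_mul, descTransf_inv, hu1, hκ]
    funext x
    simp

end Lift

/-! ## §2 At a minimiser, Prop. 7 clause 1 ⟺ the lifting token (`L ≥ 5`) -/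

section Iff

/-- ★★ **AT PRINT'S REGULAR MINIMISER: PROP. 7 CLAUSE 1 AT `(ε₀, V)` ⟺ «THE DATUM's SYMMETRIES LIFT».**  For every `L ≥ 5` there is `e₈ > 0` (pen 7's) such that at every member
`(F, J < K)`, every `0 < ε₀ ≤ e₈`, every datum `V` and every `U₀ ∈ regFibrePr ε₀ V` realising `minActionRegPr ε₀ V`:
`(varProblem3 F J K hJK.le).AtMostOneCriticalOrbit ε₀ V ↔ hlift(V,U₀)` (§1 for `→`; ✓FILE 1 §2 = ✓pen 7 §4 witnessed by `U₀` for `←`).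
[cite: Balaban1985Variational, (4)-(6) p.278, Thm 1 (8)-(10) p.279, (111) p.294, Prop. 7 and (141)-(143) p.299] -/
theorem atMostOneCriticalOrbit_iff_symmetriesLift_at_min_five (L : ℕ) (h5 : 5 ≤ L) :
    ∃ e₈ : ℝ, 0 < e₈ ∧
      ∀ (F : T3Family), F.L = L → ∀ (J K : ℕ) (hJK : J < K) (ε₀ : ℝ)
        (V : GaugeField (F.P J) 0 (Matrix.specialUnitaryGroup (Fin 2) ℂ)) (U₀ : GaugeField (F.P K) 0 (Matrix.specialUnitaryGroup (Fin 2) ℂ)),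
        0 < ε₀ → ε₀ ≤ e₈ → U₀ ∈ regFibrePr F J K hJK.le ε₀ V → wilsonAction4 U₀ = minActionRegPr F J K hJK.le ε₀ V →
        ((varProblem3 F J K hJK.le).AtMostOneCriticalOrbit ε₀ V ↔
          ∀ s : GaugeTransf (F.P J) 0 (Matrix.specialUnitaryGroup (Fin 2) ℂ), GaugeField.gaugeAct s V = V →
            ∃ k : GaugeTransf (F.P K) 0 (Matrix.specialUnitaryGroup (Fin 2) ℂ), GaugeField.gaugeAct k U₀ = U₀ ∧ descTransf F J K hJK.le k = s) := by
  obtain ⟨e₈, he₈, H⟩ := atMostOneCriticalOrbit_of_isCritR2_of_lift_five L h5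
  refine ⟨e₈, he₈, ?_⟩
  intro F hF J K hJK ε₀ V U₀ hε₀ hεe hU₀reg hmin
  refine ⟨fun h1 => symmetriesLift_of_atMostOneCriticalOrbit F hJK.le hε₀ V U₀ h1 hU₀reg hmin, fun hlift => ?_⟩
  exact H F hF J K hJK ε₀ V U₀ hε₀ hεe hU₀reg
    (isCritR2_of_isMinOn hε₀ hU₀reg (isMinOn_iff.mpr fun W hW => hmin.trans_le (minActionRegPr_le F hW))) hlift

end Iff

/-! ## §3 TUBE♭ ∕ GAP♭ at print's regular minimiser from Prop. 7 clause 1 at `(ε₀, V)` alone -/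

section Gap

/-- ★★★ **TUBE♭(V,U₀) FOR EVERY SMALL TUBE RADIUS ⟸ {PROP. 7 CL. 1 at `(ε₀, V)`, CL(V)}** (`L ≥ 5`, `ε₀ ≤ e₉(L)`; TUBE♭ text VERBATIM; `δ₀` per base point).
✓FILE 1 `tubeGrowth_smallTube_at_isCritR2_of_lift_of_CL_five` ∘ §1.
[cite: Balaban1985Variational, (4)-(6) p.278, Thm 1 (8)-(10) p.279, Prop. 7 and (141)-(143) p.299; Balaban1985UV3, (12)-(13) p.259 and (18)-(22) p.260] -/
theorem tubeGrowth_smallTube_at_min_of_atMostOneCriticalOrbit_of_CL_five (L : ℕ) (h5 : 5 ≤ L) :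
    ∃ e₉ : ℝ, 0 < e₉ ∧
      ∀ (F : T3Family), F.L = L → ∀ (J K : ℕ) (hJK : J < K) (γ b₀ p₀ ε₀ : ℝ)
        (V : GaugeField (F.P J) 0 (Matrix.specialUnitaryGroup (Fin 2) ℂ)) (U₀ : GaugeField (F.P K) 0 (Matrix.specialUnitaryGroup (Fin 2) ℂ)),
        0 < ε₀ → ε₀ ≤ e₉ → U₀ ∈ regFibrePr F J K hJK.le ε₀ V →
        wilsonAction4 U₀ = minActionRegPr F J K hJK.le ε₀ V →
        (varProblem3 F J K hJK.le).AtMostOneCriticalOrbit ε₀ V →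
        closure (fibre F ℰp J K hJK.le V ∩ histGood F ℰp (θBal F.L γ b₀ p₀) K J) ⊆ fibre F ℰp J K hJK.le V →
        ∃ δ₀ : ℝ, 0 < δ₀ ∧ ∀ δ : ℝ, δ ≤ δ₀ →
        ∃ μ : ℝ, 0 < μ ∧ ∀ U ∈ fibre F ℰp J K hJK.le V, U ∈ histGood F ℰp (θBal F.L γ b₀ p₀) K J →
          (∃ w : Site (F.P K) 0 → Matrix.specialUnitaryGroup (Fin 2) ℂ,
              (∀ U'' : GaugeField (F.P K) 0 (Matrix.specialUnitaryGroup (Fin 2) ℂ),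
                  descendTo F ℰp J K hJK.le (GaugeField.gaugeAct w U'') = descendTo F ℰp J K hJK.le U'') ∧
                ∀ ℓ : PBond (F.P K) 0, dist1 (U ℓ * ((GaugeField.gaugeAct w U₀) ℓ)⁻¹) ≤ δ) →
          μ * ((F.L : ℝ)⁻¹) ^ (2 * (K - J)) *
              (⨅ w : {w : Site (F.P K) 0 → Matrix.specialUnitaryGroup (Fin 2) ℂ |
                  ∀ U : GaugeField (F.P K) 0 (Matrix.specialUnitaryGroup (Fin 2) ℂ),
                    descendTo F ℰp J K hJK.le (GaugeField.gaugeAct w U) = descendTo F ℰp J K hJK.le U},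
                ∑ ℓ : PBond (F.P K) 0,
                  dist1 (U ℓ * ((GaugeField.gaugeAct (w : Site (F.P K) 0 → Matrix.specialUnitaryGroup (Fin 2) ℂ) U₀) ℓ)⁻¹) ^ 2)
            ≤ wilsonAction4 U - minActionRegPr F J K hJK.le ε₀ V := by
  obtain ⟨e₉, he₉, H⟩ := tubeGrowth_smallTube_at_isCritR2_of_lift_of_CL_five L h5
  refine ⟨e₉, he₉, ?_⟩
  intro F hF J K hJK γ b₀ p₀ ε₀ V U₀ hε₀ hεe hU₀reg hmin h1 hCL
  exact H F hF J K hJK γ b₀ p₀ ε₀ V U₀ hε₀ hεe hU₀reg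
    (isCritR2_of_isMinOn hε₀ hU₀reg (isMinOn_iff.mpr fun W hW => hmin.trans_le (minActionRegPr_le F hW))) hmin
    (symmetriesLift_of_atMostOneCriticalOrbit F hJK.le hε₀ V U₀ h1 hU₀reg hmin) hCL

/-- ★★★★ **GAP♭(V,U₀) AT PRINT'S REGULAR MINIMISER ⟸ {PROP. 7 CL. 1 at `(ε₀, V)`, `hreg`(δ)}, UNIFORMLY IN `γ ≤ γ*(L,b₀,p₀,δ)`.**  For every `L ≥ 5`, `b₀, p₀ > 0` and
`δ > 0` there are `e₉, γ* > 0` such that at every member `(F, γ ≤ γ*, J < K)`, every `0 < ε₀ ≤ e₉`, every datum `V` with `(varProblem3 F J K hJK.le).AtMostOneCriticalOrbit ε₀ V`, every good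
history `U₀ ∈ regFibrePr ε₀ V` realising `minActionRegPr ε₀ V`, under `hreg`(δ) (✓px8's binder VERBATIM): GAP♭(V,U₀) (the (T3) dock's text VERBATIM).  ✓FILE 1 `gapFlat_at_min_of_lift_of_hreg_five` ∘ §1.
[cite: Balaban1985Variational, (4)-(6) p.278, Thm 1 (8)-(10) p.279, Prop. 7 and (141)-(143) p.299; Balaban1985UV3, (12)-(13) p.259 and (18)-(22) p.260; Balaban1985RegularSpaces, Lemma 1 (1.24)-(1.26) p.79] -/
theorem gapFlat_at_min_of_atMostOneCriticalOrbit_of_hreg_five (L : ℕ) (h5 : 5 ≤ L) (b₀ p₀ : ℝ) (hb : 0 < b₀) (hp : 0 < p₀) (δ : ℝ) (hδ : 0 < δ) :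
    ∃ e₉ γs : ℝ, 0 < e₉ ∧ 0 < γs ∧
      ∀ (F : T3Family) (γ : ℝ), F.L = L → 0 < γ → γ ≤ γs → ∀ (J K : ℕ) (hJK : J < K) (ε₀ : ℝ)
        (V : GaugeField (F.P J) 0 (Matrix.specialUnitaryGroup (Fin 2) ℂ)) (U₀ : GaugeField (F.P K) 0 (Matrix.specialUnitaryGroup (Fin 2) ℂ)),
        0 < ε₀ → ε₀ ≤ e₉ → U₀ ∈ regFibrePr F J K hJK.le ε₀ V →
        wilsonAction4 U₀ = minActionRegPr F J K hJK.le ε₀ V → U₀ ∈ histGood F ℰp (θBal F.L γ b₀ p₀) K J →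
        (varProblem3 F J K hJK.le).AtMostOneCriticalOrbit ε₀ V →
        (∀ U ∈ closure (fibre F ℰp J K hJK.le V ∩ histGood F ℰp (θBal F.L γ b₀ p₀) K J),
            (∃ w : Site (F.P K) 0 → Matrix.specialUnitaryGroup (Fin 2) ℂ,
              (∀ U'' : GaugeField (F.P K) 0 (Matrix.specialUnitaryGroup (Fin 2) ℂ),
                  descendTo F ℰp J K hJK.le (GaugeField.gaugeAct w U'') = descendTo F ℰp J K hJK.le U'') ∧
                ∀ ℓ : PBond (F.P K) 0, dist1 (U ℓ * ((GaugeField.gaugeAct w U₀) ℓ)⁻¹) ≤ δ) →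
            wilsonAction4 U ≤ minActionRegPr F J K hJK.le ε₀ V → U ∈ regFibrePr F J K hJK.le ε₀ V) →
        ∃ μ : ℝ, 0 < μ ∧ ∀ U ∈ fibre F ℰp J K hJK.le V, U ∈ histGood F ℰp (θBal F.L γ b₀ p₀) K J →
          μ * ((F.L : ℝ)⁻¹) ^ (2 * (K - J)) *
              (⨅ w : {w : Site (F.P K) 0 → Matrix.specialUnitaryGroup (Fin 2) ℂ |
                  ∀ U : GaugeField (F.P K) 0 (Matrix.specialUnitaryGroup (Fin 2) ℂ),
                    descendTo F ℰp J K hJK.le (GaugeField.gaugeAct w U) = descendTo F ℰp J K hJK.le U},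
                ∑ ℓ : PBond (F.P K) 0,
                  dist1 (U ℓ * ((GaugeField.gaugeAct (w : Site (F.P K) 0 → Matrix.specialUnitaryGroup (Fin 2) ℂ) U₀) ℓ)⁻¹) ^ 2)
            ≤ wilsonAction4 U - minActionRegPr F J K hJK.le ε₀ V := by
  obtain ⟨e₉, γs, he₉, hγs, H⟩ := gapFlat_at_min_of_lift_of_hreg_five L h5 b₀ p₀ hb hp δ hδ
  refine ⟨e₉, γs, he₉, hγs, ?_⟩
  intro F γ hF hγ hγle J K hJK ε₀ V U₀ hε₀ hεe hU₀reg hmin hU₀h h1 hreg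
  exact H F γ hF hγ hγle J K hJK ε₀ V U₀ hε₀ hεe hU₀reg hmin hU₀h
    (symmetriesLift_of_atMostOneCriticalOrbit F hJK.le hε₀ V U₀ h1 hU₀reg hmin) hreg

/-- ★★★★ **GAP♭(V,U₀) AT PRINT'S REGULAR MINIMISER ⟸ PROP. 7 CLAUSE 1 AT `(ε₀, V)` ALONE, for all `γ ≤ γ*(U₀)`.**  For every `L ≥ 5` and `b₀, p₀ > 0` there is `e₉ > 0` such
that at every member `(F, J < K)`, every `0 < ε₀ ≤ e₉`, every datum `V` with `(varProblem3 F J K hJK.le).AtMostOneCriticalOrbit ε₀ V` and every `U₀ ∈ regFibrePr ε₀ V` realising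
`minActionRegPr ε₀ V`, there is `γ* > 0` with: for every `0 < γ ≤ γ*` such that `U₀` is a good history, GAP♭(V,U₀) (VERBATIM).  ✓FILE 1 `gapFlat_at_min_of_lift_five` ∘ §1.  The ONLY
per-datum letter is PRINT'S Prop. 7 clause 1 at the pair `(ε₀, V)`; base-point rows = EXW∘'s; the price is the per-base-point `γ*` — NOT the organ's datum-free order.
[cite: Balaban1985Variational, (4)-(6) p.278, Thm 1 (8)-(10) p.279, Prop. 7 and (141)-(143) p.299; Balaban1985UV3, (12)-(13) p.259 and (18)-(22) p.260; Balaban1985RegularSpaces, Lemma 1 (1.24)-(1.26) p.79] -/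
theorem gapFlat_at_min_of_atMostOneCriticalOrbit_five (L : ℕ) (h5 : 5 ≤ L) (b₀ p₀ : ℝ) (hb : 0 < b₀) (hp : 0 < p₀) :
    ∃ e₉ : ℝ, 0 < e₉ ∧
      ∀ (F : T3Family), F.L = L → ∀ (J K : ℕ) (hJK : J < K) (ε₀ : ℝ)
        (V : GaugeField (F.P J) 0 (Matrix.specialUnitaryGroup (Fin 2) ℂ)) (U₀ : GaugeField (F.P K) 0 (Matrix.specialUnitaryGroup (Fin 2) ℂ)),
        0 < ε₀ → ε₀ ≤ e₉ → U₀ ∈ regFibrePr F J K hJK.le ε₀ V →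
        wilsonAction4 U₀ = minActionRegPr F J K hJK.le ε₀ V →
        (varProblem3 F J K hJK.le).AtMostOneCriticalOrbit ε₀ V →
        ∃ γs : ℝ, 0 < γs ∧ ∀ (γ : ℝ), 0 < γ → γ ≤ γs → U₀ ∈ histGood F ℰp (θBal F.L γ b₀ p₀) K J →
        ∃ μ : ℝ, 0 < μ ∧ ∀ U ∈ fibre F ℰp J K hJK.le V, U ∈ histGood F ℰp (θBal F.L γ b₀ p₀) K J →
          μ * ((F.L : ℝ)⁻¹) ^ (2 * (K - J)) *
              (⨅ w : {w : Site (F.P K) 0 → Matrix.specialUnitaryGroup (Fin 2) ℂ |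
                  ∀ U : GaugeField (F.P K) 0 (Matrix.specialUnitaryGroup (Fin 2) ℂ),
                    descendTo F ℰp J K hJK.le (GaugeField.gaugeAct w U) = descendTo F ℰp J K hJK.le U},
                ∑ ℓ : PBond (F.P K) 0,
                  dist1 (U ℓ * ((GaugeField.gaugeAct (w : Site (F.P K) 0 → Matrix.specialUnitaryGroup (Fin 2) ℂ) U₀) ℓ)⁻¹) ^ 2)
            ≤ wilsonAction4 U - minActionRegPr F J K hJK.le ε₀ V := by
  obtain ⟨e₉, he₉, H⟩ := gapFlat_at_min_of_lift_five L h5 b₀ p₀ hb hp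
  refine ⟨e₉, he₉, ?_⟩
  intro F hF J K hJK ε₀ V U₀ hε₀ hεe hU₀reg hmin h1
  exact H F hF J K hJK ε₀ V U₀ hε₀ hεe hU₀reg hmin (symmetriesLift_of_atMostOneCriticalOrbit F hJK.le hε₀ V U₀ h1 hU₀reg hmin)

end Gap

end Summit.QuantumFields.YangMills.Theorems.FluctuationComparisonRegPrIntLS2BetaLiftOfCriticalOrbitUnique

end
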